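import Mathlib
import Summits.AtomisticToContinuum.Crystallization.Theorems.ChargedEnergyGap.Negative.Unconditional
import Summits.AtomisticToContinuum.Crystallization.Theorems.ChargedEnergyGap.Negative.Periodisation
import Summits.AtomisticToContinuum.Crystallization.Theorems.PricedLinkCensusStackingHingePricedOfPeriodic
import Literature.MathematicalPhysics.StatisticalMechanics.LennardJonesClusters

/-!
# Route PricedLinkCensus — `N·e* < E_LJ(y)` strictly, for every finite injective configuration
(stub `stub_eStarStrict` of line Sketch for `StackingHinge`, stmt-AtomisticToContinuum-14993)

The tree proves `N·e* ≤ E_LJ(y)` for every injective `y : Fin N → ℝ³`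
(`ChargedEnergyGapNegative.card_mul_eStar_le`: periodise `y` with the cubic lattice `cℤ³`,
`c ≥ 2Σ‖yᵢ‖ + 2`; the periodic images are at mutual distances `≥ 2`, where `V_LJ ≤ 0`, so
`e(periodisation) ≤ E_LJ(y)/N`, and `e* ≤ e(periodisation)` since `e*` is a genuine infimum,
`bddBelow_energyPerParticle_lennardJones`).  Here we sharpen it to the STRICT inequality
`N·e* < E_LJ(y)` for `N ≥ 1`: among the terms dropped when comparing the lattice sum at `yᵢ` with
the finite site energy `∑_{k ≠ i} V_LJ(|yᵢ − y_k|)` is the interaction of `yᵢ` with its own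
translate `yᵢ + c·e₀` (a point of the periodised configuration, distinct from every `y_j`, at
distance `≥ 2` from `yᵢ`), whose value is `V_LJ(r) < 0` (`r > 1`).  Hence the lattice sum at
every site is STRICTLY below the site energy (`tsum_lt_siteEnergy`), so
`e(periodisation) < E_LJ(y)/N` (`energyPerParticle_periodise_lt`) and
`N·e* ≤ N·e(periodisation) < E_LJ(y)`.

Use in the line: along configurations `y_n` with `E(y_n) ≤ N_n (e* + 1/n)` the particle numbers
`N_n → ∞` (for each fixed `N` the excess `E − N e*` of an `N`-point configuration is `> 0`).

All `[folklore]`; bookkeeping with `sum_le_hasSum` on the summable Lennard-Jones lattice sum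
(`PeriodicConfiguration.summable_lennardJones_dist_three`); motif/point membership of the sites
from `PricedHcpWindowsPeriodicTransfer` (`mem_motif_periodise`, `mem_points_periodise`).
-/

noncomputable section

namespace Summit.AtomisticToContinuum.Crystallization.Theorems.PricedHcpWindowsEStarStrict

open Filter Topology
open Literature.MathematicalPhysics.StatisticalMechanics
open Summit.AtomisticToContinuum.Crystallization.Theorems.ChargedEnergyGapNegative
open Summit.AtomisticToContinuum.Crystallization.Theorems.PricedHcpWindowsPeriodicTransfer
  (mem_motif_periodise mem_points_periodise)
open Literature.Barriers.AtomisticToContinuum (cubicLattice cubicBasis cubicBasis_apply)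
open scoped BigOperators

variable {N : ℕ} {x : Fin N → E3}

/-- The lattice of periods of the periodisation is the cubic lattice `cℤ³`. [folklore] -/
theorem lattice_periodise (x : Fin N → E3) (c : ℝˣ) (hc : period x ≤ (c : ℝ)) (hN : 0 < N) :
    (periodise x c hc hN).lattice = cubicLattice c := rfl

/-- The translate `x i + c·e₀` of a site by the first period differs from every site `x j`
(motif points are pairwise inequivalent modulo the lattice, and `c·e₀ ≠ 0`). [folklore] -/
theorem add_cubicBasis_ne (x : Fin N → E3) (c : ℝˣ) (hc : period x ≤ (c : ℝ)) (hN : 0 < N)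
    (i j : Fin N) : x i + cubicBasis c 0 ≠ x j := by
  intro hj
  have hgL : cubicBasis c 0 ∈ (periodise x c hc hN).lattice := by
    rw [lattice_periodise]
    exact Submodule.subset_span (Set.mem_range_self _)
  have hsub : x j - x i ∈ (periodise x c hc hN).lattice := by
    rw [← hj, add_sub_cancel_left]
    exact hgL
  have heq := (periodise x c hc hN).eq_of_sub_mem (x j) (mem_motif_periodise x c hc hN j)
    (x i) (mem_motif_periodise x c hc hN i) hsub
  have h0 : cubicBasis c 0 = 0 := by
    have h2 : x i + cubicBasis c 0 = x i := hj.trans heq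
    simpa using h2
  exact (cubicBasis c).ne_zero 0 h0

/-- The translate `x i + c·e₀` is a point of the periodisation. [folklore] -/
theorem add_cubicBasis_mem_points (x : Fin N → E3) (c : ℝˣ) (hc : period x ≤ (c : ℝ))
    (hN : 0 < N) (i : Fin N) : x i + cubicBasis c 0 ∈ (periodise x c hc hN).points := by
  refine (periodise x c hc hN).add_mem_points
    (mem_points_periodise x c hc hN i) ?_
  rw [lattice_periodise]
  exact Submodule.subset_span (Set.mem_range_self _)

/-- **Strict site comparison.**  The lattice sum at `xᵢ` over the periodisation is STRICTLY
below the finite site energy `∑_{k ≠ i} V_LJ(|xᵢ − x_k|)`: the remaining terms are `≤ 0`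
(points of other copies are at distance `≥ 2`), and one of them — the interaction with the
translate `xᵢ + c·e₀`, at distance `≥ 2 > 1` — is `< 0` (`lennardJones_neg`). [folklore] -/
theorem tsum_lt_siteEnergy (hx : Function.Injective x) (c : ℝˣ) (hc : period x ≤ (c : ℝ))
    (hN : 0 < N) (i : Fin N) :
    (∑' y : {y : E3 // y ∈ (periodise x c hc hN).points ∧ y ≠ x i},
        lennardJones (dist (x i) y.1)) < siteEnergy lennardJones x i := by
  have hfar : ∀ j, x i + cubicBasis c 0 ≠ x j := add_cubicBasis_ne x c hc hN i
  have htP : x i + cubicBasis c 0 ∈ (periodise x c hc hN).points :=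
    add_cubicBasis_mem_points x c hc hN i
  have hdist : 2 ≤ dist (x i) (x i + cubicBasis c 0) :=
    two_le_dist_of_mem_points x c hc hN i htP hfar
  set P := periodise x c hc hN with hP
  set f : {y : E3 // y ∈ P.points ∧ y ≠ x i} → ℝ := fun y => lennardJones (dist (x i) y.1)
    with hf
  have hsum : Summable f := P.summable_lennardJones_dist_three (x i)
  -- the original sites `x k`, `k ≠ i`, as points of the periodisation
  have hmem : ∀ k : {k // k ∈ Finset.univ.erase i}, x k.1 ∈ P.points ∧ x k.1 ≠ x i := fun k =>
    ⟨mem_points_periodise x c hc hN k.1,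
      hx.ne (Finset.ne_of_mem_erase k.2)⟩
  set emb : {k // k ∈ Finset.univ.erase i} → {y : E3 // y ∈ P.points ∧ y ≠ x i} :=
    fun k => ⟨x k.1, hmem k⟩ with hemb
  have hinj : Function.Injective emb := by
    intro k l hkl
    have h1 : x k.1 = x l.1 := congrArg Subtype.val hkl
    exact Subtype.ext (hx h1)
  set s₀ : Finset {y : E3 // y ∈ P.points ∧ y ≠ x i} := (Finset.univ.erase i).attach.image emb
    with hs₀
  -- the translate, a point of the periodisation outside `s₀` with a strictly negative term
  set t : {y : E3 // y ∈ P.points ∧ y ≠ x i} := ⟨x i + cubicBasis c 0, htP, hfar i⟩ with ht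
  have ht₀ : t ∉ s₀ := by
    intro hts
    obtain ⟨k, -, hk⟩ := Finset.mem_image.1 hts
    exact hfar k.1 (congrArg Subtype.val hk).symm
  have hft : f t < 0 := by
    show lennardJones (dist (x i) (x i + cubicBasis c 0)) < 0
    exact lennardJones_neg (by linarith)
  have hsign : ∀ y ∉ insert t s₀, 0 ≤ (fun b => -f b) y := by
    intro y hy
    have hy₀ : y ∉ s₀ := fun h => hy (Finset.mem_insert_of_mem h)
    have hfar' : ∀ j, y.1 ≠ x j := by
      intro j hj
      by_cases hji : j = i
      · exact y.2.2 (hji ▸ hj)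
      · exact hy₀ (Finset.mem_image.2 ⟨⟨j, Finset.mem_erase.2 ⟨hji, Finset.mem_univ j⟩⟩,
          Finset.mem_attach _ _, Subtype.ext hj.symm⟩)
    have h1 := two_le_dist_of_mem_points x c hc hN i y.2.1 hfar'
    simp only [hf, neg_nonneg]
    exact lennardJones_nonpos (by linarith)
  have h1 := sum_le_hasSum (insert t s₀) hsign hsum.hasSum.neg
  have h2 : ∑ y ∈ s₀, f y = siteEnergy lennardJones x i := by
    rw [hs₀, Finset.sum_image fun k _ l _ h => hinj h]
    exact Finset.sum_attach (Finset.univ.erase i) fun k => lennardJones (dist (x i) (x k))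
  rw [Finset.sum_insert ht₀, Finset.sum_neg_distrib, h2] at h1
  linarith

/-- Hence `e(periodisation of x) < E_LJ(x)/N` for `N ≥ 1` (strict at every site, summed over the
motif `{xᵢ}` of cardinality `N`). [folklore] -/
theorem energyPerParticle_periodise_lt (hx : Function.Injective x) (c : ℝˣ)
    (hc : period x ≤ (c : ℝ)) (hN : 0 < N) :
    (periodise x c hc hN).energyPerParticle lennardJones <
      interactionEnergy lennardJones x / N := by
  have hcard : (periodise x c hc hN).motif.card = N := by
    rw [motif_periodise, Finset.card_image_of_injective _ hx, Finset.card_univ, Fintype.card_fin]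
  have hNr : (0 : ℝ) < N := by exact_mod_cast hN
  unfold PeriodicConfiguration.energyPerParticle
  rw [hcard]
  have hsum : ∑ z ∈ (periodise x c hc hN).motif,
      ∑' y : {y : E3 // y ∈ (periodise x c hc hN).points ∧ y ≠ z}, lennardJones (dist z y.1) <
        ∑ i, siteEnergy lennardJones x i := by
    rw [motif_periodise, Finset.sum_image fun i _ j _ h => hx h]
    exact Finset.sum_lt_sum (fun i _ => (tsum_lt_siteEnergy hx c hc hN i).le)
      ⟨⟨0, hN⟩, Finset.mem_univ _, tsum_lt_siteEnergy hx c hc hN _⟩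
  rw [← two_mul_interactionEnergy] at hsum
  calc (2 * (N : ℝ))⁻¹ * ∑ z ∈ (periodise x c hc hN).motif,
        ∑' y : {y : E3 // y ∈ (periodise x c hc hN).points ∧ y ≠ z}, lennardJones (dist z y.1)
      < (2 * (N : ℝ))⁻¹ * (2 * interactionEnergy lennardJones x) :=
        mul_lt_mul_of_pos_left hsum (by positivity)
    _ = interactionEnergy lennardJones x / N := by
        field_simp

/-- **`N·e* < E_LJ(y)` strictly, for every injective configuration of `N ≥ 1` points of `ℝ³`**
(stub `stub_eStarStrict` of line Sketch for `StackingHinge`): `e* ≤ e(periodisation of y)`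
(`ciInf_le`, the range of `e_LJ` over periodic configurations is bounded below,
`bddBelow_energyPerParticle_lennardJones`) and `e(periodisation) < E_LJ(y)/N`
(`energyPerParticle_periodise_lt`). [folklore] -/
theorem stub_eStarStrict : ∀ (N : ℕ) (y : Fin N → EuclideanSpace ℝ (Fin 3)), 0 < N → Function.Injective y → (N : ℝ) * (⨅ Q : Literature.MathematicalPhysics.StatisticalMechanics.PeriodicConfiguration 3, Q.energyPerParticle Literature.MathematicalPhysics.StatisticalMechanics.lennardJones) < Literature.MathematicalPhysics.StatisticalMechanics.interactionEnergy Literature.MathematicalPhysics.StatisticalMechanics.lennardJones y := by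
  intro N y hN hy
  show (N : ℝ) * eStar < interactionEnergy lennardJones y
  have h1 : eStar ≤ (periodise y (periodUnit y) le_rfl hN).energyPerParticle lennardJones :=
    ciInf_le bddBelow_energyPerParticle_lennardJones _
  have h2 := energyPerParticle_periodise_lt hy (periodUnit y) le_rfl hN
  have hNr : (0 : ℝ) < N := by exact_mod_cast hN
  have h3 := h1.trans_lt h2
  rwa [lt_div_iff₀ hNr, mul_comm] at h3

end Summit.AtomisticToContinuum.Crystallization.Theorems.PricedHcpWindowsEStarStrict

end
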